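import Summits.CriticalPhenomena.SAWScalingLimit.Theorems.SAWDevelopingMapObservableToSLETypeLadderCarvedReductionSqueezeHexagons
import HarnessLib

/-!
# The face of a point and the continuum core of a fat spine (piece (G1-face) of stub T2b″)

Crux `SAWDevelopingMap.ObservableToSLE` (stmt-CriticalPhenomena-10472), line `six-class-type-ladder`,
stub T2b″ `stub_carvedReduction_squeezeSolid`.  Landing target:
`Summits/CriticalPhenomena/SAWScalingLimit/Theorems/SAWDevelopingMapObservableToSLETypeLadderCarvedReductionSqueezeFaces.lean`
(`--supports stmt-CriticalPhenomena-10472`).  Sequel of `…SqueezeHexagons` (p133791).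

The FAT-SPINE clause of the solid families is a LATTICE statement (every vertex whose rescaled centre
is within `ρ/8` of the spine `K` belongs to the level).  The squeeze uses its CONTINUUM form: the
closed `(ρ/8 - 3δ)`-neighbourhood of `K` lies in the removed set `⋃ contHex δ t r` of the listed
hexagons of the level (so the open core `N_{ρ/8}(K_∞)` of the limit spine is persistently removed,
and the legs of the gate cross-cuts can be routed through it).  The passage is the elementary

* `exists_face_of_point` — every point of the plane lies in the closed `δ𝕋`-triangle of some face
  `v` (its three rescaled skew coordinates lie in `[δ rowCoord i v, δ (rowCoord i v + 1)]`), whose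
  rescaled centre is within `3δ`;
* `mem_contHex_of_face` — if that face belongs to `hexBall t r` then the point lies in
  `contHex δ t r`;
* `fatSpine_core_subset` — the continuum core statement (registered as
  `stub_carvedReduction_fatSpineCore`).
-/

noncomputable section

open scoped Topology
open Filter Set Metric
open Literature.Probability.LatticeModels (HexVertex hexGraph hexCenter Site)
open Literature.Probability.RandomPlanarGeometry

namespace Summit.CriticalPhenomena.SAWScalingLimit.Theorems.ObservableToSLE.TypeLadder

open Summit.CriticalPhenomena.SAWScalingLimit.Theorems.ObservableToSLER.BridgeGate

/-- `skewCoord 2 = skewCoord 0 + skewCoord 1` (the three line families are dependent). -/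
theorem skewCoord_two_eq (z : ℂ) : skewCoord 2 z = skewCoord 0 z + skewCoord 1 z := by
  simp [skewCoord]; ring

/-- **The face of a point.**  For `0 < δ`, every point `z` lies in the closed rescaled triangle of
some face `v`: `δ rowCoord i v ≤ skewCoord i z ≤ δ (rowCoord i v + 1)` for the three row families,
and then `dist z (δ c_v) ≤ 3δ`. -/
theorem exists_face_of_point {δ : ℝ} (hδ : 0 < δ) (z : ℂ) :
    ∃ v : HexVertex, (∀ i : Fin 3, δ * (rowCoord i v : ℝ) ≤ skewCoord i z ∧
      skewCoord i z ≤ δ * ((rowCoord i v : ℝ) + 1)) ∧ dist z ((δ : ℂ) * hexCenter v) ≤ 3 * δ := by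
  -- skew coordinates at scale `δ`
  set s : Fin 3 → ℝ := fun i => skewCoord i z / δ with hs
  have hsz : ∀ i, skewCoord i z = δ * s i := fun i => by rw [hs]; field_simp
  have hs2 : s 2 = s 0 + s 1 := by
    simp only [hs]; rw [skewCoord_two_eq, add_div]
  set m₀ : ℤ := ⌊s 0⌋ with hm₀
  set m₁ : ℤ := ⌊s 1⌋ with hm₁
  have h00 : (m₀ : ℝ) ≤ s 0 := Int.floor_le _
  have h01 : s 0 < m₀ + 1 := Int.lt_floor_add_one _
  have h10 : (m₁ : ℝ) ≤ s 1 := Int.floor_le _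
  have h11 : s 1 < m₁ + 1 := Int.lt_floor_add_one _
  -- the triangle type
  set x : Site 2 := ![m₁, m₀] with hx
  have hx0 : x 0 = m₁ := by simp [hx]
  have hx1 : x 1 = m₀ := by simp [hx]
  by_cases ht : s 2 < m₀ + m₁ + 1
  · -- up-triangle
    refine ⟨(x, 0), fun i => ?_, ?_⟩
    · rw [hsz i]
      fin_cases i <;> simp [rowCoord, hx0, hx1] <;> constructor <;> nlinarith [hs2]
    · have key : ∀ i : Fin 3, |skewCoord i z - skewCoord i ((δ : ℂ) * hexCenter (x, 0))| ≤ δ := by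
        intro i
        rw [skewCoord_real_mul, hsz i, ← mul_sub, abs_mul, abs_of_pos hδ]
        refine mul_le_of_le_one_right hδ.le ?_
        obtain ⟨ha, hb⟩ := skewCoord_hexCenter_mem i ((x, 0) : HexVertex)
        fin_cases i <;> simp [rowCoord, hx0, hx1] at ha hb ⊢ <;> rw [abs_le] <;> constructor <;>
          nlinarith [hs2]
      have h := norm_le_skewCoord (z - (δ : ℂ) * hexCenter (x, 0))
      rw [skewCoord_sub, skewCoord_sub] at h
      rw [dist_eq_norm]
      linarith [key 0, key 1]
  · -- down-triangle
    push Not at ht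
    refine ⟨(x, 1), fun i => ?_, ?_⟩
    · rw [hsz i]
      fin_cases i <;> simp [rowCoord, hx0, hx1] <;> constructor <;> nlinarith [hs2]
    · have key : ∀ i : Fin 3, |skewCoord i z - skewCoord i ((δ : ℂ) * hexCenter (x, 1))| ≤ δ := by
        intro i
        rw [skewCoord_real_mul, hsz i, ← mul_sub, abs_mul, abs_of_pos hδ]
        refine mul_le_of_le_one_right hδ.le ?_
        obtain ⟨ha, hb⟩ := skewCoord_hexCenter_mem i ((x, 1) : HexVertex)
        fin_cases i <;> simp [rowCoord, hx0, hx1] at ha hb ⊢ <;> rw [abs_le] <;> constructor <;>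
          nlinarith [hs2]
      have h := norm_le_skewCoord (z - (δ : ℂ) * hexCenter (x, 1))
      rw [skewCoord_sub, skewCoord_sub] at h
      rw [dist_eq_norm]
      linarith [key 0, key 1]

/-- **A point lies in the continuum hexagon of every lattice hexagon containing its face.** -/
theorem mem_contHex_of_face {δ : ℝ} (hδ : 0 < δ) {z : ℂ} {v t : HexVertex} {r : ℕ}
    (hv : ∀ i : Fin 3, δ * (rowCoord i v : ℝ) ≤ skewCoord i z ∧ skewCoord i z ≤ δ * ((rowCoord i v : ℝ) + 1))
    (hvt : v ∈ hexBall t r) : z ∈ contHex δ t r := by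
  rw [contHex_eq_skewHex hδ]
  intro i
  obtain ⟨h1, h2⟩ := hv i
  have h3 := hvt i
  rw [abs_le] at h3
  obtain ⟨h3a, h3b⟩ := h3
  have h4 : ((rowCoord i t : ℤ) : ℝ) - r ≤ rowCoord i v := by exact_mod_cast (by linarith : rowCoord i t - (r : ℤ) ≤ rowCoord i v)
  have h5 : ((rowCoord i v : ℤ) : ℝ) ≤ rowCoord i t + r := by exact_mod_cast (by linarith : rowCoord i v ≤ rowCoord i t + (r : ℤ))
  constructor <;> nlinarith

/-- **The continuum core of a fat spine.**  If every vertex whose rescaled centre is within `c` of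
the set `K` belongs to a vertex set `L` which is a union of listed lattice hexagons, then every POINT
within `c - 3δ` of `K` lies in the union of the corresponding continuum hexagons. -/
theorem fatSpine_core_subset {δ c : ℝ} (hδ : 0 < δ) {K : Set ℂ} {L : Set HexVertex}
    (hL : ∀ v : HexVertex, infDist ((δ : ℂ) * hexCenter v) K ≤ c → v ∈ L)
    {ι : Type*} {t : ι → HexVertex} {r : ι → ℕ} (hcover : ∀ v ∈ L, ∃ j, v ∈ hexBall (t j) (r j))
    {z : ℂ} (hz : infDist z K ≤ c - 3 * δ) : ∃ j, z ∈ contHex δ (t j) (r j) := by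
  obtain ⟨v, hv, hdist⟩ := exists_face_of_point hδ z
  have hvK : infDist ((δ : ℂ) * hexCenter v) K ≤ c := by
    have h1 := infDist_le_infDist_add_dist (s := K) (x := (δ : ℂ) * hexCenter v) (y := z)
    rw [dist_comm] at h1
    linarith
  obtain ⟨j, hj⟩ := hcover v (hL v hvK)
  exact ⟨j, mem_contHex_of_face hδ hv hj⟩

/-- **Registered sub-goal `stub_carvedReduction_fatSpineCore`** (crux item stmt-CriticalPhenomena-10472,
stub T2b″ `stub_carvedReduction_squeezeSolid`, piece (G1-face) THE CONTINUUM CORE OF A FAT SPINE):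
registry form of `fatSpine_core_subset` for a list-indexed cover (as in `TameNestedFamily`). -/
theorem stub_carvedReduction_fatSpineCore :
    ∀ (δ c : ℝ) (K : Set ℂ) (L : Set HexVertex) (Lst : List (HexVertex × ℕ)) (z : ℂ), 0 < δ →
      (∀ v : HexVertex, infDist ((δ : ℂ) * hexCenter v) K ≤ c → v ∈ L) →
      (∀ v : HexVertex, v ∈ L ↔ ∃ tk ∈ Lst, v ∈ hexBall tk.1 tk.2) →
      infDist z K ≤ c - 3 * δ → ∃ tk ∈ Lst, z ∈ contHex δ tk.1 tk.2 := by
  intro δ c K L Lst z hδ hL hLst hz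
  have hcover : ∀ v ∈ L, ∃ j : {tk // tk ∈ Lst}, v ∈ hexBall (j.1.1) (j.1.2) := by
    intro v hv
    obtain ⟨tk, htk, hvtk⟩ := (hLst v).1 hv
    exact ⟨⟨tk, htk⟩, hvtk⟩
  obtain ⟨j, hj⟩ := fatSpine_core_subset hδ hL (t := fun j : {tk // tk ∈ Lst} => j.1.1)
    (r := fun j => j.1.2) hcover hz
  exact ⟨j.1, j.2, hj⟩

end Summit.CriticalPhenomena.SAWScalingLimit.Theorems.ObservableToSLE.TypeLadder

end
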